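import Summits.QuantumFields.YangMills.Theorems.BalabanUVNodesN27AtAdmReadingOfRecord13CoPHInductive
import Summits.QuantumFields.YangMills.Theorems.BalabanUVNodesN27AtRecord13CoPHHolder

/-!
# BalabanUVNodes ∕ N27 = binder B5 AT THE RECORD — (A)ʰ: THE R-β TWIN OF (A) `…N27AtAdmReadingOfRecord13CoPHInductive` (p554797): XLIᶜᵒᵖᴴ AT THE ADMISSIBLE `CoPH`-KEYED STAGE-13 READING OF
# RECORD WITH N18 IN THE PRINT's INDUCTIVE (STEP) CURRENCY, NOW WITH NODE N16 IN ITS CURRENCY OF RECORD «R-β» (plan g77 N16 PICK; plan g79 W-SEAT-START-LIST v5 §n27 (W-b) «R-β TWINS OF THE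
# ADMISSIBLE-READING N18-CURRENCY LEAVES (A) Inductive … each = the β = 1 file with `h16`'s `InEndRegime ∧ LeafSlotAT ↦ InEndRegimeH ∧ LeafSlotHolderAT … β` (39ᴴ), `h19`'s `RatesAt ↦ RatesHolderAt … β` (41ᴴ),
# base knit XLᶜᵒᵖᴴ ↦ (Q) §2»)
# (cell `pub-ymgap`, HUMAN RULING D-0062 Track A; director-ym №197 ∕ HUMAN RULING D-0149 width seats; seat `pub-ymgap-dag-n17-w3` on row N27 by plan's release; K3⁷ `SpineGivenEndpointR13SepCoPH` =
# stmt-QuantumFields-20544, `--kind proof --supports 20544 --as helper`; COUNT-NEUTRAL; THEOREMS ONLY, 0 `def`, 0 `sorry`; `N`-generic, regime-generic, NO Theses import)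

THE KIT PATTERN.  PARENT = (A) §2 `spine_rec13CCoPHOn_at_readingAdm₁₃CoPH_of_inductiveStep` (dag-n27-c g9): every binder VERBATIM — the residual DATA `S sp gauge hg T₀ hT₀ li ℓ₃ ne2 ne1`, the
regime `Rg`, NE1′ ∕ NE2 in guarded θ-form, dag-n18-d's INDUCTIVE (STEP) row `h18` (THE END's data over the carriers of the admissible level pairing + the towers' H-layer data on the tables obtained
STEP BY STEP, envelope numerals), dag-n22-e 8a″'s STRIP letters `hjunk hnum hstrip`, (D4) `hD4`, the K5 side `h20 h21 hx` — EXCEPT the three R-β tokens: `h16` reads `InEndRegimeH ∧ LeafSlotHolderAT … β`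
(dag-n16-c's Hölder LETTER face at the AT-keyed all-torus leaf, [Balaban1985RegularSpaces] (1.36) p. 82 «β ≦ β₀ < 1»), `h19`'s antecedent reads `RatesHolderAt … β` (dag-n16-e 41ᴴ), and the base knit is (Q) §2
`spine_rec13CCoPHOn_at_readingOfRecord₁₃CoPH_holder` (dag-n27-c g10, p581033) with `h16` closed by 39ᴴ `s_N16Holder_readingOfRecord₁₃CoPHOn_of_leafSlotHolderAT hβ0 hβ1`; `hβ0 hβ1` are the theorem's
leading binders (`0 ≤ β ≤ 1`; the consumers' window `2∕3 < β < 1` lies inside).  The canonical-home §1 of (A) has no R-β parent of record ((Q) is regime-only) and is NOT twinned.  (A), (Q), 39ᴴ, 41ᴴ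
and every landed declaration UNTOUCHED (additive file); nothing re-declared.

WHAT IS KERNEL-CHECKED ([bookkeeping]; ONE theorem, 0 `def`, 0 `sorry`): ★★ `spine_rec13CCoPHOn_at_readingAdm₁₃CoPH_holder_of_inductiveStep` — N27 = B5 at node00-def-RR-2's regime record class
from the slots at the regime home of node00-def-W1's ADMISSIBLE reading `ReadingData.ofRecordAdm`, N18 in the (STEP) currency, N22 eliminated given N18 (STRIP), N17 eliminated ((Q) §2 via dag-n17-a
`s_N17_of_D4_N18`), N16 AT EXPONENT `β` in the given-letters AT-leaf currency, the N19′ edge reading `RatesHolderAt … β`.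

HONEST FRAMING.  COMPOSITE-node bookkeeping BY NAME; no estimate of its own.  The (STEP) schema is dag-n18-c's cell paraphrase of the H-layer induction behind [Balaban1988RG2Cluster] Lemma 3,
NOT Bałaban's sentence and NOT proved for his towers; NE3 at exponent β, NE1′ ∕ NE2 ∕ (D4), the STRIP letters, NE7 ∕ NE7b ∕ NE7c and the extraction clause are HYPOTHESES asserted for no
family (0∕1 at the ₁₃ record today — K0⁷ OPEN, no `Provisos₁₃CoPH` inhabitant claimed); transports ∕ letters are residual DATA; nothing of Bałaban's asserted or instantiated; N16 ∕ N18 ∕ N22 ∕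
N27 NOT discharged; K3⁷ NOT claimed; counts UNMOVED (typed 28∕28 · discharged 5∕27, A 5∕28); one finite four-torus programme at fixed `ε` — R4 closes the conditional rung `BalabanLadder.UV`
only; NOT ℝ⁴, NOT infinite volume, NOT OS, NOT a mass gap, NOT Clay.  No decl below carries a cite tag.
-/

namespace Summit.QuantumFields.YangMills.Theorems.BalabanUVNodesN27SpineRecord

open Set Metric
open scoped Matrix.Norms.L2Operator

open Literature.MathematicalPhysics.QuantumFieldTheory.Balaban1983to89
open Literature.MathematicalPhysics.QuantumFieldTheory.Balaban1983to89.T4Continuum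
open Literature.MathematicalPhysics.QuantumFieldTheory.Balaban1983to89.T4OutputRate (Carriers Functional NE5 DecayBound Window)
open Literature.MathematicalPhysics.QuantumFieldTheory.Balaban1983to89.TreeLengthTorus (TDom tsys torusTreeLen)
open Literature.MathematicalPhysics.QuantumFieldTheory.Balaban1983to89.T4InputCauchyRateData (StepModel)
open Literature.MathematicalPhysics.QuantumFieldTheory.Balaban1983to89.B13Resummation (locE)
open Literature.MathematicalPhysics.QuantumFieldTheory.Balaban1983to89.TreeLengthTorusGeometry (TTouch)
open Literature.MathematicalPhysics.QuantumFieldTheory.Balaban1983to89.B12TreeDecay (K₀)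
open Summit.QuantumFields.BalabanUV.T4Continuum.Spine.NE5
open YMDAG.N18.HLayer
open YMDAG.N18.W1Reading (s_N18_rRec₁₃CoPH_readingAdm_of_inductiveStep_pin s_N18_rRec₁₃CoPHOn_readingAdm_of_inductiveStep_pin)
open T4ContinuumYM4Torus (ForSmallCouplings)
open Summit.QuantumFields.BalabanUV.T4Continuum.Spine
open YMDAG.UVSplit
open Node00 (Stage13HParams datumOfRecord₁₃CoPH IsRecordOfRecord₁₃CCoPH IsDatumOfRecord₁₃CCoPH NE3Letters₁₁ NE2Objects₁₁ ne3ConstLayerOfRecord₁₁ MatA ιSU prependCoupling)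
open Node00.Sect2 (domCount domSys CPair ofBackgroundC)
open Node00.W1 (ReadingData LevelPairing LetterInputs ClusterTower pairOfRecord functionalC termC box SpRestr AdmBg)
open YMDAG.N22 (s_N22_readingOfRecord₁₃CoPH_ofRecordAdm_of_s_N18_analytic s_N22_readingOfRecord₁₃CoPHOn_ofRecordAdm_of_s_N18_stripBound)
open Summit.QuantumFields.YangMills.BalabanUVNodes.N16Regime (InEndRegime)
open Summit.QuantumFields.YangMills.BalabanUVNodes.N16LeafSlot (LeafSlot)
open Summit.QuantumFields.YangMills.BalabanUVNodes.N16AtRRec13CoPH (s_N16_rRec₁₃CoPH_of_constLayer_leafSlot s_N16_rRec₁₃CoPHOn_ofRecord_of_leafSlot)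
open Summit.QuantumFields.YangMills.BalabanUVNodes.N16HolderDefs (N16HolderAt S_N16Holder)
open Summit.QuantumFields.YangMills.BalabanUVNodes.SpineRatesHolder (RatesHolderAt)
open Summit.QuantumFields.YangMills.BalabanUVNodes.N16HolderRegime (InEndRegimeH)
open Summit.QuantumFields.YangMills.BalabanUVNodes.N16LeafSlotAllTorus (LeafSlotHolderAT)
open Summit.QuantumFields.YangMills.BalabanUVNodes.N16AtRRec13CoPHLeafSlotAT (s_N16Holder_readingOfRecord₁₃CoPHOn_of_leafSlotHolderAT)

variable {N : ℕ} [NeZero N] (cr : SpineReading₁₃CoPH N)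
  (S : (F : T4Family) → (θ : Stage13HParams F N) → (k : ℕ) → ClusterTower (F.P k) (MatA N) θ.τ9.M)
  (sp : (F : T4Family) → (θ : Stage13HParams F N) → (k j : ℕ) → (domSys (F.P k) θ.τ9.M j).Dom → Set (CPair (F.P k) (MatA N)))
  (gauge : (F : T4Family) → (θ : Stage13HParams F N) → (k : ℕ) → GaugeField (F.P k) 0 (Node00.SU N) → GaugeField (F.P k) 0 (Node00.SU N) → ℝ)
  (hg : ∀ (F : T4Family) (θ : Stage13HParams F N) (k : ℕ) (U U' : GaugeField (F.P k) 0 (Node00.SU N)), 0 ≤ gauge F θ k U U')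
  (T₀ : (F : T4Family) → (θ : Stage13HParams F N) → (k : ℕ) → GaugeField (F.P (k + 1)) 0 (Node00.SU N) → GaugeField (F.P k) 0 (Node00.SU N))
  (hT₀ : ∀ (F : T4Family) (θ : Stage13HParams F N) (k : ℕ) (U : GaugeField (F.P (k + 1)) 0 (Node00.SU N)),
    (∀ (j : ℕ) (Y : (domSys (F.P (k + 1)) θ.τ9.M j).Dom), ofBackgroundC (ιSU N) U ∈ sp F θ (k + 1) j Y) →
      ∀ (j : ℕ) (X : (domSys (F.P k) θ.τ9.M j).Dom), ofBackgroundC (ιSU N) (T₀ F θ k U) ∈ sp F θ k j X)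
  (li : (F : T4Family) → Stage13HParams F N → LetterInputs) (ℓ₃ : T4Family → NE3Letters₁₁)
  (ne2 : (F : T4Family) → Stage13HParams F N → (ℕ → ℝ) → List (ULoop F) → ℕ → NE2Objects₁₁)
  (ne1 : (F : T4Family) → Stage13HParams F N → (ℕ → ℝ) → List (ULoop F) → NE1pCarriers)

/-! ## §1 The regime home at the admissible reading of record, N18 in the (STEP) currency, N16 at exponent `β` -/

section Regime

variable (Rg : (F : T4Family) → Stage13HParams F N → Prop)

open Classical in
/-- ★★ **N27 = B5 AT THE REGIME RECORD CLASS `IsRecordOfRecord₁₃CCoPHOn F N Rg` FROM THE SLOTS AT THE REGIME HOME OF THE ADMISSIBLE READING OF RECORD, NODE N16 IN ITS CURRENCY OF RECORD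
R-β, ANY `Rg` — N17 ∕ N22 ELIMINATED, N18 FROM THE END's DATA AND THE INDUCTIVE (STEP) SCHEMAS ASKED ONLY OF THE TUPLES IN THE REGIME** ((A) `spine_rec13CCoPHOn_at_readingAdm₁₃CoPH_of_inductiveStep`'s
R-β twin: base knit (Q) §2 `spine_rec13CCoPHOn_at_readingOfRecord₁₃CoPH_holder` at the admissible `w1 := ReadingData.ofRecordAdm …`, `h18` ⟸ dag-n18-d's
`YMDAG.N18.W1Reading.s_N18_rRec₁₃CoPHOn_readingAdm_of_inductiveStep_pin` at `hpin := readingOfRecord₁₃CoPH_u3 …` — hypothesis VERBATIM —, N22 ⟸ that N18 by dag-n22-e's regime edge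
`YMDAG.N22.s_N22_readingOfRecord₁₃CoPHOn_ofRecordAdm_of_s_N18_stripBound` in the STRIP currency ((J), twelve numerals, STRIP-(1.18) VERBATIM), NE1′ on `ne1 F θ g₀ os`, NE2 on `ne2 F θ g₀ os k`
for tuples in the regime, NE3 AT EXPONENT `β` as `InEndRegimeH ∧ LeafSlotHolderAT … β` once per guarded family (dag-n16-e 39ᴴ `s_N16Holder_readingOfRecord₁₃CoPHOn_of_leafSlotHolderAT hβ0 hβ1`,
`0 ≤ β ≤ 1`), (D4) at θ, spine side N20 ∕ N21 at `SRec₁₃CoPHOn cr Rg`, the guarded keyed extraction clause, the same-tuple N19′ edge READING dag-n16-e 41ᴴ's `RatesHolderAt … β`).  At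
`Rg := Node00.unityNondeg₁₃H 2` ∕ the item's guard, `N = 2` THE ITEM follows by leaf A §4 ∕ XXXVIᶜᵒᵖᴴ as leaf E does.  Every hypothesis 0∕1 today; NE3 at exponent β NOT PROVED. [bookkeeping] -/
theorem spine_rec13CCoPHOn_at_readingAdm₁₃CoPH_holder_of_inductiveStep {β : ℝ} (hβ0 : 0 ≤ β) (hβ1 : β ≤ 1)
    (h14 : ∀ (F : T4Family) (θ : Stage13HParams F N), θ.Provisos₁₃CoPH F N → Rg F θ → θ.Admissible F N → ∀ (g₀ : ℕ → ℝ) (os : List (ULoop F)),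
      N14At (ne1 F θ g₀ os))
    (h15 : ∀ (F : T4Family) (θ : Stage13HParams F N), θ.Provisos₁₃CoPH F N → Rg F θ → θ.Admissible F N → ∀ (g₀ : ℕ → ℝ) (os : List (ULoop F)) (k : ℕ),
      N15At (ne2OfRecord₁₁ (ne2 F θ g₀ os k)))
    (h16 : ∀ (F : T4Family), (∃ θ : Stage13HParams F N, θ.Provisos₁₃CoPH F N ∧ Rg F θ ∧ θ.Admissible F N) →
      InEndRegimeH (ne3OfRecord₁₁ F (ne3ConstLayerOfRecord₁₁ F N (ℓ₃ F))) ∧ LeafSlotHolderAT (ne3OfRecord₁₁ F (ne3ConstLayerOfRecord₁₁ F N (ℓ₃ F))) β)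
    -- N18 ⟸ THE END's data + the INDUCTIVE (STEP) schemas, asked of the tuples IN THE REGIME (dag-n18-d `s_N18_rRec₁₃CoPHOn_readingAdm_of_inductiveStep_pin`, verbatim)
    (h18 : ∀ (F : T4Family) (θ : Stage13HParams F N), θ.Provisos₁₃CoPH F N → Rg F θ → θ.Admissible F N → ∀ k : ℕ,
      ∃ (Op : Type) (_ : NormedAddCommGroup Op) (_ : NormedSpace ℂ Op) (Hist : Type) (_ : NormedAddCommGroup Hist) (_ : NormedSpace ℂ Hist)
        (Mb : ℝ → StepModel (LevelPairing.ofRecordAdm F θ.τ9.M N k (sp F θ) (gauge F θ k) (hg F θ k) (T₀ F θ k) (hT₀ F θ k)).carriers Op Hist)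
        (act : ℝ → (j : ℕ) → Op × Hist → TDom 4 (domCount (F.P k) θ.τ9.M j) → ℂ) (γ' C3 ε₁ Rd κ A_A A_B E_A E_B E₁ δ δ' θr θ' cH ω ρ₀ B : ℝ)
        (k₀ : ℕ),
        (∀ b : ℝ, 0 < b → b ≤ γ' → ∀ (X : Node00.W1.Dom (F.P k) θ.τ9.M) (z : Op × Hist),
          (Mb b).Out X.1 z.1 z.2 X =
            locE (TTouch (d := 4) (N := domCount (F.P k) θ.τ9.M X.1)) (fun Z : (tsys 4 (domCount (F.P k) θ.τ9.M X.1)).Dom => Z.1)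
              (act b X.1 z) X.2.1) ∧
        0 ≤ C3 ∧ 0 ≤ ε₁ ∧ 0 ≤ κ ∧ κ + 2 * (64 * Real.log 162) + 2 ≤ Rd ∧
        C3 * ε₁ * Real.exp (5 * κ + 1) * K₀ 64 8 * 9 * 64 ≤ 1 ∧
        (∀ b : ℝ, 0 < b → b ≤ γ' → ∀ j, ∀ g ∈ Window γ',
          ∀ (U : (LevelPairing.ofRecordAdm F θ.τ9.M N k (sp F θ) (gauge F θ k) (hg F θ k) (T₀ F θ k) (hT₀ F θ k)).BgB) (q : Op × Hist),
          q ∈ (Mb b).Base j g U →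
          ∃ V : Set (Op × Hist), IsOpen V ∧ (Mb b).box j q ⊆ V ∧
            (∀ Z : TDom 4 (domCount (F.P k) θ.τ9.M j), DifferentiableOn ℂ (fun z : Op × Hist => act b j z Z) V) ∧
            (∀ z ∈ V, ∀ Z : TDom 4 (domCount (F.P k) θ.τ9.M j), ‖act b j z Z‖ ≤ C3 * ε₁ * Real.exp (-(Rd * torusTreeLen Z.1)))) ∧
        (∀ b : ℝ, 0 < b → b ≤ γ' → L01 (Mb b)
          ((LevelPairing.ofRecordAdm F θ.τ9.M N k (sp F θ) (gauge F θ k) (hg F θ k) (T₀ F θ k) (hT₀ F θ k)).EA (S F θ k)) (Window γ')) ∧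
        (∀ b : ℝ, 0 < b → b ≤ γ' → L02 (Mb b)
          ((LevelPairing.ofRecordAdm F θ.τ9.M N k (sp F θ) (gauge F θ k) (hg F θ k) (T₀ F θ k) (hT₀ F θ k)).EB (S F θ (k + 1)) b)
          (Window γ')) ∧
        (∀ b : ℝ, 0 < b → b ≤ γ' → L03 (Mb b)
          ((LevelPairing.ofRecordAdm F θ.τ9.M N k (sp F θ) (gauge F θ k) (hg F θ k) (T₀ F θ k) (hT₀ F θ k)).EB (S F θ (k + 1)) b)
          (Window γ')) ∧
        (∀ b : ℝ, 0 < b → b ≤ γ' → L07 (Mb b) (Window γ') δ θr) ∧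
        (∀ b : ℝ, 0 < b → b ≤ γ' → L08 (Mb b) (Window γ') κ (Real.exp 1 * 9 * 64 * K₀ 64 8 ^ 2 * A_B) δ' θr) ∧
        (∀ b : ℝ, 0 < b → b ≤ γ' → L09aff (Mb b) (Window γ')) ∧ (∀ b : ℝ, 0 < b → b ≤ γ' → L09blind (Mb b) (Window γ')) ∧
        (∀ b : ℝ, 0 < b → b ≤ γ' → L09hom (Mb b) (Window γ')) ∧ (∀ b : ℝ, 0 < b → b ≤ γ' → L09unit (Mb b) (Window γ') κ E₁ cH ω) ∧
        0 < E₁ ∧ 0 ≤ δ + δ' ∧ 0 ≤ θr ∧ θr ≤ θ' ∧ θ' ≤ 1 ∧ 0 ≤ cH ∧ 0 < ω ∧ ρ₀ < 1 ∧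
        (δ + δ') * θr ^ k₀ +
            cH * (Real.exp 1 * 9 * 64 * K₀ 64 8 ^ 2 * A_A + Real.exp 1 * 9 * 64 * K₀ 64 8 ^ 2 * A_B) / (1 - ω) ≤ ρ₀ ∧
        0 ≤ B ∧ (∀ k < k₀, Real.exp 1 * 9 * 64 * K₀ 64 8 ^ 2 * A_A + Real.exp 1 * 9 * 64 * K₀ 64 8 ^ 2 * A_B ≤ B * θr ^ k) ∧
        Real.exp 1 * 9 * 64 * K₀ 64 8 ^ 2 * C3 * cH * ε₁ < (θ' - ω) * (1 - ρ₀) ∧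
        (∀ m, SpRestr (sp F θ k (m + 1))) ∧
        (∀ m : ℕ,
          (∀ g ∈ Window γ', ∀ j ≤ m, ∀ (X : (domSys (F.P k) θ.τ9.M j).Dom), ∀ φ ∈ sp F θ k j X,
              ‖termC (S F θ k) j X g φ‖ ≤ E_A * Real.exp (-(κ * (domSys (F.P k) θ.τ9.M j).dj X))) →
          (∀ g ∈ Window γ', ∀ j ≤ m, ∀ (X : (domSys (F.P k) θ.τ9.M j).Dom), AnalyticOnNhd ℂ (termC (S F θ k) j X g) (sp F θ k j X)) →
          (S F θ k m).AnalyticH (box γ' m) (sp F θ k (m + 1)) ∧ (S F θ k m).Bound238 (box γ' m) (sp F θ k (m + 1)) A_A Rd) ∧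
        0 ≤ A_A ∧ A_A * Real.exp (5 * κ + 1) * K₀ 64 8 * 9 * 64 < 1 ∧ Real.exp 1 * 9 * 64 * K₀ 64 8 ^ 2 * A_A ≤ E_A ∧
        (∀ m, SpRestr (sp F θ (k + 1) (m + 1))) ∧
        (∀ m : ℕ,
          (∀ g ∈ Window γ', ∀ j ≤ m, ∀ (Y : (domSys (F.P (k + 1)) θ.τ9.M j).Dom), ∀ φ ∈ sp F θ (k + 1) j Y,
              ‖termC (S F θ (k + 1)) j Y g φ‖ ≤ E_B * Real.exp (-(κ * (domSys (F.P (k + 1)) θ.τ9.M j).dj Y))) →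
          (∀ g ∈ Window γ', ∀ j ≤ m, ∀ (Y : (domSys (F.P (k + 1)) θ.τ9.M j).Dom),
              AnalyticOnNhd ℂ (termC (S F θ (k + 1)) j Y g) (sp F θ (k + 1) j Y)) →
          (S F θ (k + 1) m).AnalyticH (box γ' m) (sp F θ (k + 1) (m + 1)) ∧
            (S F θ (k + 1) m).Bound238 (box γ' m) (sp F θ (k + 1) (m + 1)) A_B Rd) ∧
        0 ≤ A_B ∧ A_B * Real.exp (5 * κ + 1) * K₀ 64 8 * 9 * 64 < 1 ∧ Real.exp 1 * 9 * 64 * K₀ 64 8 ^ 2 * A_B ≤ E_B ∧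
        θ.γ ≤ γ' ∧ (li F θ).κ ≤ κ ∧ θ' ≤ (li F θ).θ₅ ∧
        (Real.exp 1 * 9 * 64 * K₀ 64 8 ^ 2 * (C3 * ε₁) / (1 - ρ₀) * (δ + δ') + B) * (θ' - ω) /
            (θ' - (ω + Real.exp 1 * 9 * 64 * K₀ 64 8 ^ 2 * (C3 * ε₁) / (1 - ρ₀) * cH)) ≤ (li F θ).C₅)
    -- N22 ⟸ N18 (dag-n22-e module 8a″, STRIP currency on the reading's OWN table, NO readings clause): (J), twelve numerals, STRIP-(1.18) — verbatim
    (hjunk : ∀ (F : T4Family) (θ : Stage13HParams F N), θ.Provisos₁₃CoPH F N → Rg F θ → θ.Admissible F N →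
      ∀ (k : ℕ) (X : Node00.W1.Dom (F.P k) θ.τ9.M), k < X.1 → ∀ (g : ℕ → ℝ) (φ : CPair (F.P k) (MatA N)), functionalC (S F θ k) g φ X = 0)
    (hnum : ∀ (F : T4Family) (θ : Stage13HParams F N), θ.Provisos₁₃CoPH F N → Rg F θ → θ.Admissible F N →
      0 < (li F θ).C₀ ∧ 0 < (li F θ).θ₅ ∧ (li F θ).θ₅ < 1 ∧ 0 ≤ (li F θ).C₅ ∧ 2 * (li F θ).C₅ / (1 - (li F θ).θ₅) ≤ (li F θ).C₀ ∧ 0 < (li F θ).A ∧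
        (li F θ).θ₅ ≤ (li F θ).μ ∧ (li F θ).C₀ ≤ 2 * (li F θ).A ∧ 0 < (li F θ).r ∧ 0 < (li F θ).s ∧ (li F θ).s < 1 ∧ 1 ≤ (li F θ).μ)
    (hstrip : ∀ (F : T4Family) (θ : Stage13HParams F N), θ.Provisos₁₃CoPH F N → Rg F θ → θ.Admissible F N → ∀ (k : ℕ),
      ∀ (j : ℕ) (g : ℕ → ℝ), g ∈ Window θ.γ → ∀ (i : ℕ) (Y : (domSys (F.P k) θ.τ9.M j).Dom) (ψ : CPair (F.P k) (MatA N)), ψ ∈ sp F θ k j Y →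
        ∃ (Ec : ℂ → ℂ) (O : Set ℂ), IsOpen O ∧ (∀ t ∈ Ioc (0 : ℝ) θ.γ, closedBall (t : ℂ) (li F θ).r ⊆ O) ∧ DifferentiableOn ℂ Ec O ∧
          (∀ z ∈ O, ‖Ec z‖ ≤ (li F θ).A * Real.exp (-((li F θ).κ * torusTreeLen Y.1))) ∧
          (∀ t ∈ Ioc (0 : ℝ) θ.γ, Ec t = termC (S F θ k) j Y (Function.update g i t) ψ))
    (hD4 : ∀ (F : T4Family) (θ : Stage13HParams F N) (hP : θ.Provisos₁₃CoPH F N), Rg F θ → θ.Admissible F N → ∀ k : ℕ,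
      ReadOutAt (datumOfRecord₁₃CoPH F N θ hP) (u3OfRecord₁₃ θ.toStage13Params
        ((ReadingData.ofRecordAdm F θ.τ9.M N (S F θ) (sp F θ) (gauge F θ) (hg F θ) (T₀ F θ) (hT₀ F θ) (li F θ)).u3Objects θ.γ) k))
    (h20 : S_N20 (SRec₁₃CoPHOn cr Rg)) (h21 : S_N21 (SRec₁₃CoPHOn cr Rg))
    (hx : ∀ (F : T4Family) (θ : Stage13HParams F N) (hP : θ.Provisos₁₃CoPH F N), Rg F θ → θ.Admissible F N →
      B16.EndStatementBPrinted (datumOfRecord₁₃CoPH F N θ hP).C → DagBinding.EndpointExistence (datumOfRecord₁₃CoPH F N θ hP).C.toB12 →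
        ForSmallCouplings (datumOfRecord₁₃CoPH F N θ hP) fun g₀ => ∀ os : List (ULoop F),
          0 < (cr F θ hP g₀ os).l₀ ∧ 0 < (cr F θ hP g₀ os).vol ∧
          (∀ (K : ℕ) (t : ℝ), |t| ≤ (cr F θ hP g₀ os).l₀ →
            T4GenFunBounds.schemeZ ((datumOfRecord₁₃CoPH F N θ hP).scheme g₀) os ((cr F θ hP g₀ os).K₀ + K) t =
              ∑ τ ∈ (cr F θ hP g₀ os).T K, (cr F θ hP g₀ os).A K t τ) ∧
          (∀ (K : ℕ) (t : ℝ), |t| ≤ (cr F θ hP g₀ os).l₀ →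
            T4GenFunBounds.schemeZ ((datumOfRecord₁₃CoPH F N θ hP).scheme g₀) os ((cr F θ hP g₀ os).K₀ + K + 1) t =
              ∑ τ ∈ (cr F θ hP g₀ os).T K, (cr F θ hP g₀ os).B K t τ))
    (h19 : ∀ (F : T4Family) (θ : Stage13HParams F N) (hP : θ.Provisos₁₃CoPH F N), Rg F θ → θ.Admissible F N → ∀ (g₀ : ℕ → ℝ) (os : List (ULoop F)),
      (∀ k : ℕ, RatesHolderAt (datumOfRecord₁₃CoPH F N θ hP) (rateCarriersOfRecord₁₃CoPH (readingOfRecord₁₃CoPH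
        (fun F θ => ReadingData.ofRecordAdm F θ.τ9.M N (S F θ) (sp F θ) (gauge F θ) (hg F θ) (T₀ F θ) (hT₀ F θ) (li F θ)) ℓ₃ ne2 ne1) F θ hP g₀ os k) β) →
        letI := (cr F θ hP g₀ os).dec
        ∃ δ : ℕ → ℝ, NE7.Core (cr F θ hP g₀ os).l₀ (cr F θ hP g₀ os).vol (cr F θ hP g₀ os).T (cr F θ hP g₀ os).Bad
          (fun K t τ => (cr F θ hP g₀ os).A K t τ - (cr F θ hP g₀ os).shA K t τ) (fun K t τ => (cr F θ hP g₀ os).B K t τ - (cr F θ hP g₀ os).shB K t τ) δ ∧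
          Summable δ) :
    Spine (N := N) fun F D w => Node00.IsRecordOfRecord₁₃CCoPHOn F N Rg D w :=
  have h18' : S_N18 (RRec₁₃CoPHOn (readingOfRecord₁₃CoPH
      (fun F θ => ReadingData.ofRecordAdm F θ.τ9.M N (S F θ) (sp F θ) (gauge F θ) (hg F θ) (T₀ F θ) (hT₀ F θ) (li F θ)) ℓ₃ ne2 ne1) Rg) :=
    s_N18_rRec₁₃CoPHOn_readingAdm_of_inductiveStep_pin _ Rg S sp gauge hg T₀ hT₀ li (readingOfRecord₁₃CoPH_u3 _ ℓ₃ ne2 ne1) h18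
  spine_rec13CCoPHOn_at_readingOfRecord₁₃CoPH_holder cr β _ ne2 ne1 Rg ℓ₃
    ((s_N14_rRec₁₃CoPHOn_iff _ Rg).mpr fun F θ hP hRg hθ g₀ os => h14 F θ hP hRg hθ g₀ os)
    ((s_N15_rRec₁₃CoPHOn_iff _ Rg).mpr fun F θ hP hRg hθ g₀ os k => h15 F θ hP hRg hθ g₀ os k)
    (s_N16Holder_readingOfRecord₁₃CoPHOn_of_leafSlotHolderAT (Rg := Rg)
      (w1 := fun F θ => ReadingData.ofRecordAdm F θ.τ9.M N (S F θ) (sp F θ) (gauge F θ) (hg F θ) (T₀ F θ) (hT₀ F θ) (li F θ)) (ℓ₃ := ℓ₃) (ne2 := ne2) (ne1 := ne1)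
      hβ0 hβ1 h16)
    h18' (s_N22_readingOfRecord₁₃CoPHOn_ofRecordAdm_of_s_N18_stripBound S sp gauge hg T₀ hT₀ li ℓ₃ ne2 ne1 Rg h18' hjunk hnum hstrip)
    ((s_D4_rRec₁₃CoPHOn_iff _ Rg).mpr fun F θ hP hRg hθ _ _ k => hD4 F θ hP hRg hθ k) h20 h21 hx h19

end Regime

end Summit.QuantumFields.YangMills.Theorems.BalabanUVNodesN27SpineRecord
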